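import Mathlib
import HarnessLib
import Summits.NavierStokesRegularity.NavierStokesRegularity.Theorems.UnthreadedRigidityDoorUnthreadedRigidityVirialHornTwoChannelPlateauCascade

/-!
# Route `UnthreadedRigidityDoor`, item `UnthreadedRigidity` (W2, stmt-NavierStokesRegularity-27585) — LINE g11-1 «VIRIAL HORN»,
# BRIDGE V BY NAME («PLATEAU PROPAGATION»), file 13: ★★★ `orderTwoSliceLaw_holds`, `orderTwoVirialIdentity_holds` (BRIDGE V BY NAME), `separableOrderTwoRigidityL_holds` (THE SLICE RUNG BY NAME)

Prover file (W2 Lean hand ns-crc-p1 g10, by lineage; `--supports stmt-NavierStokesRegularity-27585 --as helper`; objects BY NAME in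
`Theorems/UnthreadedRigidityDoorUnthreadedRigidityVirialHornTwoChannelDefs.lean`, p726708 / p728780 and its second append).

Content: the RAY PREMISE `premiseRay` (`α(r)²𝒜(rŷ) − {Y, z·∇p₀(x₀+z)}(rŷ)`) and its closed form `premiseRayExp` on `(0,∞)` (★ `premiseRay_eq_exp`,
pressure bracket of file 5 + scaling of the brackets); ★ `premiseRayExp_killed` (on a plateau the closed form is killed by an integer Euler product,
file 12); `premiseRay_eq_zero_of_vortAmpL_ne_zero` ((F2) where `K ≠ 0`); ★ `premiseRayExp_eqOn_zero_of_plateau` (PEELING on one plateau whose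
endpoint is accumulated by radii with `K ≠ 0`); ★★ `premiseRay_eq_zero` (PLATEAU PROPAGATION: the ray premise vanishes at EVERY radius — case split
accumulated / plateau to the left (`sup`) / to the right (`inf`)); ★★ `premise_of_fluxJetTwo` (the K-free premise of g8's virial lemma for every `y`);
`angForm_eq_zero_of_degree_one`; and BY NAME: ★★★ `orderTwoSliceLaw_holds : ThreadingJets.OrderTwoSliceLaw` (every `l ≥ 1`, every solid
harmonic, every virial-admissible profile — PLATEAUS INCLUDED — via `virialLemmaSlice_holds`), ★★★ `orderTwoVirialIdentity_holds :
VirialHorn.OrderTwoVirialIdentity` (BRIDGE V of LINE g11-1, via `orderTwoVirialIdentity_of_sliceLaw`), ★★★ `separableOrderTwoRigidityL_holds :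
VirialHorn.SeparableOrderTwoRigidityL` (THE SEPARABLE SLICE RUNG in every degree, via `separableOrderTwoRigidityL_of_identity` + `angularLemma_holds`).
(BRIDGE + SEPARABLE SLICE RUNG of ONE line; SPECIAL separable slice data of hypothetical order-two-silent classical solutions; MODEL rung.)
HONEST LABEL: slice-level calculus / real analysis about SPECIAL (separable) data; a piece of the L-part of ONE bridge of a RUNG line on the
wall item; `UnthreadedRigidity` (27585), W2 and NS regularity remain OPEN; nothing here is a statement about Navier–Stokes regularity.  0 kit.
-/

-- the summit and its single sub-problem share the name (CONVENTIONS §1), as in every Theorems file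
set_option linter.dupNamespace false

namespace Summit.NavierStokesRegularity.NavierStokesRegularity.Theorems.UnthreadedRigidity.VirialHorn

open scoped RealInnerProductSpace Topology Laplacian
open Filter Set MvPolynomial
open Literature.Combinatorics.LorentzianPolynomials (pderiv_pderiv_comm)
open Summit.NavierStokesRegularity.NavierStokesRegularity.Theorems.UnthreadedRigidity.ProfileHorn (E3)
open Summit.NavierStokesRegularity.NavierStokesRegularity.Theorems.UnthreadedRigidity.HornPressure (radCoeff)
open Summit.NavierStokesRegularity.NavierStokesRegularity.Theorems.PoloidalLiouville.HorizonTower hiding E3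

/-! ## §14 THE RAY PREMISE: closed form, annihilation on plateaus, propagation, and BRIDGE V BY NAME -/

section ByName

open scoped ContDiff
open MeasureTheory Literature.Analysis.FluidPDE
open Summit.NavierStokesRegularity.NavierStokesRegularity.Theorems.UnthreadedRigidity.ThreadingJets
  (fluxJetTwo virialLemmaSlice_holds orderTwoVirialIdentity_of_sliceLaw virialMoment_eq_zero_of_vortAmpL_eq_zero
    OrderTwoSliceLaw)

variable {l : ℕ} {P : MvPolynomial (Fin 3) ℝ} {H h : ℝ → ℝ} {C : ℝ} {x₀ : E3} {p₀ : E3 → ℝ}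

/-- the Euler image `(rD + c)(g(r²)) = 2r² g′(r²) + c g(r²)` of an even composite. -/
theorem eulerOp_comp_sq_apply {g : ℝ → ℝ} (hg : ContDiff ℝ ∞ g) (c : ℝ) {r : ℝ} (hr : 0 < r) :
    eulerOp c (fun x : ℝ => g (x ^ 2)) r = 2 * r ^ 2 * deriv g (r ^ 2) + c * g (r ^ 2) := by
  unfold eulerOp
  rw [deriv_profile_of_sq (H := fun x : ℝ => g (x ^ 2)) hg (fun x _ => rfl) hr]
  ring

/-- the closed form is smooth on `(0,∞)`. -/
theorem contDiffOn_premiseRayExp (hl : 1 ≤ l) (hh : ContDiff ℝ ∞ h) (hHh : ∀ r : ℝ, 0 ≤ r → H r = h (r ^ 2))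
    (hC : ∀ r : ℝ, 1 ≤ r → r ^ (l + 2) * |H r| ≤ C ∧ r ^ (l + 3) * |deriv H r| ≤ C ∧ r ^ (l + 4) * |deriv (deriv H) r| ≤ C)
    (P : MvPolynomial (Fin 3) ℝ) (ŷ : E3) : ContDiffOn ℝ ∞ (premiseRayExp l h P ŷ) (Ioi 0) := by
  unfold premiseRayExp
  refine (contDiffOn_const.mul ((contDiffOn_id.pow _).mul ?_)).sub (ContDiffOn.sum fun k hk => ?_)
  · exact (((contDiff_ampA hh l).comp (contDiff_id.pow 2)).pow 2).contDiffOn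
  · have hkl : k ≤ l := (Finset.mem_range.mp hk).le
    exact contDiffOn_const.mul ((contDiffOn_id.pow _).mul
      (contDiffOn_eulerOp (contDiffOn_cascadeCoeff_sq hl hh hHh hC hkl) _))

/-- ★ THE CLOSED FORM: on `(0,∞)` the ray premise of the degree-`l ≥ 2` shell equals `premiseRayExp` (unit `ŷ`). -/
theorem premiseRay_eq_exp (hl : 2 ≤ l) (hP : P.IsHomogeneous l) (hlap : Zonal.lapP P = 0)
    (hh : ContDiff ℝ ∞ h) (hHh : ∀ r : ℝ, 0 ≤ r → H r = h (r ^ 2))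
    (hC : ∀ r : ℝ, 1 ≤ r → r ^ (l + 2) * |H r| ≤ C ∧ r ^ (l + 3) * |deriv H r| ≤ C ∧ r ^ (l + 4) * |deriv (deriv H) r| ≤ C)
    (hsm : ContDiff ℝ (⊤ : ℕ∞) (sepShellL H (Zonal.evalE P) x₀))
    (hdiv : VectorCalculus.IsDivFree (sepShellL H (Zonal.evalE P) x₀))
    (hp : ContDiff ℝ (⊤ : ℕ∞) p₀)
    (hpoi : ∀ x : E3, (Δ p₀) x =
      -VectorCalculus.divergence (convect (sepShellL H (Zonal.evalE P) x₀) (sepShellL H (Zonal.evalE P) x₀)) x)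
    (hdec : Tendsto p₀ (cocompact E3) (𝓝 0)) {ŷ : E3} (hŷ : ‖ŷ‖ = 1) :
    EqOn (premiseRay l H (Zonal.evalE P) p₀ x₀ ŷ) (premiseRayExp l h P ŷ) (Ioi 0) := by
  intro r hr
  set Y := Zonal.evalE P with hYdef
  have hnorm : ‖r • ŷ‖ = r := by rw [norm_smul, Real.norm_eq_abs, abs_of_pos hr, hŷ, mul_one]
  have hstrain : strainAmpL l H r = ampA l h (r ^ 2) := by rw [strainAmpL_eq_of_sq l hh hHh hr]; rfl
  have hgrad : (fun z : E3 => ‖gradient Y z‖ ^ 2) = fun z => (1 / 2 : ℝ) * sqLapF Y 1 z := by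
    funext z; rw [hYdef, sqLapF_evalE, evalE_sqLapP_one hlap]; ring
  have hF1d : Differentiable ℝ (sqLapF Y 1) := by rw [hYdef, sqLapF_evalE]; exact Zonal.differentiable_evalE _
  have hang : angForm Y (r • ŷ) = (1 / 2 : ℝ) * pbr Y (sqLapF Y 1) (r • ŷ) := by
    unfold angForm; rw [hgrad, pbr_const_mul Y (1 / 2 : ℝ) (hF1d _)]
  have hpress := pbr_slicePressure_eq hl hP hlap hh hHh hC x₀ hsm hdiv hp hpoi hdec (r • ŷ)
  rw [hnorm] at hpress
  unfold premiseRay premiseRayExp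
  rw [hstrain, hang, ← hYdef, hpress, pbr_sqLapF_smul hP 1 r ŷ]
  congr 1
  · ring
  · refine Finset.sum_congr rfl fun k hk => ?_
    have hkl : k ≤ l := (Finset.mem_range.mp hk).le
    rw [← hYdef, pbr_sqLapF_smul hP k r ŷ, eulerOp_comp_sq_apply (contDiff_cascadeCoeff (by omega) hh hHh hC hkl) _ hr]
    ring

/-- ★ ON A PLATEAU THE CLOSED FORM IS KILLED by an integer Euler product. -/
theorem premiseRayExp_killed (hl : 1 ≤ l) (hh : ContDiff ℝ ∞ h) (hHh : ∀ r : ℝ, 0 ≤ r → H r = h (r ^ 2))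
    (hC : ∀ r : ℝ, 1 ≤ r → r ^ (l + 2) * |H r| ≤ C ∧ r ^ (l + 3) * |deriv H r| ≤ C ∧ r ^ (l + 4) * |deriv (deriv H) r| ≤ C)
    (P : MvPolynomial (Fin 3) ℝ) (ŷ : E3) {a b : ℝ} (ha : 0 < a) (hK : ∀ r ∈ Ioo a b, vortAmpL l H r = 0) :
    ∃ zs : List ℤ, EqOn (eulerL (zs.map (Int.cast : ℤ → ℝ)) (premiseRayExp l h P ŷ)) 0 (Ioo a b) := by
  have hJ : Ioo a b ⊆ Ioi 0 := fun r hr => ha.trans hr.1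
  -- the `ampA²` term
  have hA2 : ContDiffOn ℝ ∞ (fun x : ℝ => ampA l h (x ^ 2) ^ 2) (Ioi 0) :=
    (((contDiff_ampA hh l).comp (contDiff_id.pow 2)).pow 2).contDiffOn
  obtain ⟨-, -, pA⟩ := plateau_channels_powSums hl hh hHh ha hK
  have kA : ∃ zs : List ℤ, EqOn (eulerL (zs.map (Int.cast : ℤ → ℝ))
      (fun x : ℝ => (1 / 2 * pbr (Zonal.evalE P) (sqLapF (Zonal.evalE P) 1) ŷ)
        * (x ^ (1 + (l - 1 + (2 * l - 2 * 1 - 1))) * ampA l h (x ^ 2) ^ 2))) 0 (Ioo a b) :=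
    killed_const_mul hJ ((contDiffOn_id.pow _).mul hA2) _ (killed_pow_mul hJ hA2 _ (exists_eulerL_kill_of_powSum isOpen_Ioo hJ pA))
  -- the cascade terms
  have kS : ∀ n : ℕ, n ≤ l → ∃ zs : List ℤ, EqOn (eulerL (zs.map (Int.cast : ℤ → ℝ))
      (fun x : ℝ => ∑ k ∈ Finset.range n, pbr (Zonal.evalE P) (sqLapF (Zonal.evalE P) k) ŷ *
        (x ^ (1 + (l - 1 + (2 * l - 2 * k - 1))) * eulerOp ((2 * l - 2 * k : ℕ) : ℝ) (fun x : ℝ => cascadeCoeff l h k (x ^ 2)) x)))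
      0 (Ioo a b) := by
    intro n
    induction n with
    | zero => intro _; simpa using (killed_zero (U := Ioo a b))
    | succ n ih =>
      intro hn
      have hterm : ∀ k, k ≤ l → ContDiffOn ℝ ∞ (fun x : ℝ => pbr (Zonal.evalE P) (sqLapF (Zonal.evalE P) k) ŷ *
          (x ^ (1 + (l - 1 + (2 * l - 2 * k - 1))) * eulerOp ((2 * l - 2 * k : ℕ) : ℝ) (fun x : ℝ => cascadeCoeff l h k (x ^ 2)) x))
          (Ioi 0) := fun k hk =>
        contDiffOn_const.mul ((contDiffOn_id.pow _).mul (contDiffOn_eulerOp (contDiffOn_cascadeCoeff_sq hl hh hHh hC hk) _))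
      have hsum : ContDiffOn ℝ ∞ (fun x : ℝ => ∑ k ∈ Finset.range n, pbr (Zonal.evalE P) (sqLapF (Zonal.evalE P) k) ŷ *
          (x ^ (1 + (l - 1 + (2 * l - 2 * k - 1))) * eulerOp ((2 * l - 2 * k : ℕ) : ℝ) (fun x : ℝ => cascadeCoeff l h k (x ^ 2)) x))
          (Ioi 0) := ContDiffOn.sum fun k hk => hterm k (by have := Finset.mem_range.mp hk; omega)
      have hkn : ∃ zs : List ℤ, EqOn (eulerL (zs.map (Int.cast : ℤ → ℝ))
          (fun x : ℝ => pbr (Zonal.evalE P) (sqLapF (Zonal.evalE P) n) ŷ *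
            (x ^ (1 + (l - 1 + (2 * l - 2 * n - 1))) * eulerOp ((2 * l - 2 * n : ℕ) : ℝ) (fun x : ℝ => cascadeCoeff l h n (x ^ 2)) x)))
          0 (Ioo a b) := by
        have hg := contDiffOn_cascadeCoeff_sq hl hh hHh hC (show n ≤ l by omega)
        have hcast : (((2 * l - 2 * n : ℕ) : ℤ) : ℝ) = ((2 * l - 2 * n : ℕ) : ℝ) := by simp
        have k1 := killed_eulerOp isOpen_Ioo hJ hg ((2 * l - 2 * n : ℕ) : ℤ) (plateau_cascade_killed hl hh hHh hC ha hK n (by omega))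
        rw [hcast] at k1
        exact killed_const_mul hJ ((contDiffOn_id.pow _).mul (contDiffOn_eulerOp hg _)) _ (killed_pow_mul hJ (contDiffOn_eulerOp hg _) _ k1)
      have := killed_add isOpen_Ioo hJ hsum (hterm n (by omega)) (ih (by omega)) hkn
      refine killed_congr isOpen_Ioo (fun x hx => ?_) this
      simp only [Finset.sum_range_succ]
  have hS := kS l le_rfl
  have hsumc : ContDiffOn ℝ ∞ (fun x : ℝ => ∑ k ∈ Finset.range l, pbr (Zonal.evalE P) (sqLapF (Zonal.evalE P) k) ŷ *
      (x ^ (1 + (l - 1 + (2 * l - 2 * k - 1))) * eulerOp ((2 * l - 2 * k : ℕ) : ℝ) (fun x : ℝ => cascadeCoeff l h k (x ^ 2)) x))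
      (Ioi 0) := ContDiffOn.sum fun k hk =>
    contDiffOn_const.mul ((contDiffOn_id.pow _).mul (contDiffOn_eulerOp
      (contDiffOn_cascadeCoeff_sq hl hh hHh hC (Finset.mem_range.mp hk).le) _))
  have hA2c : ContDiffOn ℝ ∞ (fun x : ℝ => (1 / 2 * pbr (Zonal.evalE P) (sqLapF (Zonal.evalE P) 1) ŷ)
      * (x ^ (1 + (l - 1 + (2 * l - 2 * 1 - 1))) * ampA l h (x ^ 2) ^ 2)) (Ioi 0) := contDiffOn_const.mul ((contDiffOn_id.pow _).mul hA2)
  obtain ⟨zs, hz⟩ := killed_add isOpen_Ioo hJ hA2c (hsumc.const_smul (-1 : ℝ) |>.congr fun x hx => by simp [smul_eq_mul])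
    kA (killed_const_mul hJ hsumc (-1) hS)
  refine ⟨zs, fun r hr => ?_⟩
  have heq : EqOn (fun x => (1 / 2 * pbr (Zonal.evalE P) (sqLapF (Zonal.evalE P) 1) ŷ)
      * (x ^ (1 + (l - 1 + (2 * l - 2 * 1 - 1))) * ampA l h (x ^ 2) ^ 2) +
      (-1) * ∑ k ∈ Finset.range l, pbr (Zonal.evalE P) (sqLapF (Zonal.evalE P) k) ŷ *
        (x ^ (1 + (l - 1 + (2 * l - 2 * k - 1))) * eulerOp ((2 * l - 2 * k : ℕ) : ℝ) (fun x : ℝ => cascadeCoeff l h k (x ^ 2)) x))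
      (premiseRayExp l h P ŷ) (Ioo a b) := fun x hx => by unfold premiseRayExp; ring
  rw [← eulerL_congr_eqOn isOpen_Ioo heq _ hr]
  exact hz hr

/-- the ray premise vanishes where `K ≠ 0` (by (F2) and the vanishing formal second jet). -/
theorem premiseRay_eq_zero_of_vortAmpL_ne_zero (hl : 1 ≤ l) (hP : P.IsHomogeneous l) (hlap : Zonal.lapP P = 0)
    (hH : VirialAdmissible l H) (hsm : ContDiff ℝ (⊤ : ℕ∞) (sepShellL H (Zonal.evalE P) x₀))
    (hdiv : VectorCalculus.IsDivFree (sepShellL H (Zonal.evalE P) x₀)) (hp : ContDiff ℝ (⊤ : ℕ∞) p₀)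
    (hj : ∀ x : E3, fluxJetTwo (sepShellL H (Zonal.evalE P) x₀) p₀ x₀ x = 0)
    {ŷ : E3} (hŷ : ‖ŷ‖ = 1) {r : ℝ} (hr : 0 < r) (hK : vortAmpL l H r ≠ 0) :
    premiseRay l H (Zonal.evalE P) p₀ x₀ ŷ r = 0 := by
  have hY : IsSolidHarmonic l (Zonal.evalE P) := isSolidHarmonic_evalE hP hlap
  have hF2 := orderTwoLawSlice_holds l x₀ (Zonal.evalE P) H p₀ hl hY hH hsm hdiv hp (r • ŷ)
  have hnorm : ‖r • ŷ‖ = r := by rw [norm_smul, Real.norm_eq_abs, abs_of_pos hr, hŷ, mul_one]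
  rw [hj (x₀ + r • ŷ), hnorm] at hF2
  unfold premiseRay
  rcases mul_eq_zero.mp hF2.symm with h0 | h0
  · exact absurd h0 hK
  · exact h0

/-- ★ PEELING ON ONE PLATEAU: the closed form vanishes on a plateau interval `(a,b)` whose endpoint `q ∈ closure (a,b)` is
accumulated by intervals where the ray premise vanishes. -/
theorem premiseRayExp_eqOn_zero_of_plateau (hl : 2 ≤ l) (hP : P.IsHomogeneous l) (hlap : Zonal.lapP P = 0)
    (hH : VirialAdmissible l H) (hh : ContDiff ℝ ∞ h) (hHh : ∀ r : ℝ, 0 ≤ r → H r = h (r ^ 2))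
    (hC : ∀ r : ℝ, 1 ≤ r → r ^ (l + 2) * |H r| ≤ C ∧ r ^ (l + 3) * |deriv H r| ≤ C ∧ r ^ (l + 4) * |deriv (deriv H) r| ≤ C)
    (hsm : ContDiff ℝ (⊤ : ℕ∞) (sepShellL H (Zonal.evalE P) x₀))
    (hdiv : VectorCalculus.IsDivFree (sepShellL H (Zonal.evalE P) x₀)) (hp : ContDiff ℝ (⊤ : ℕ∞) p₀)
    (hpoi : ∀ x : E3, (Δ p₀) x =
      -VectorCalculus.divergence (convect (sepShellL H (Zonal.evalE P) x₀) (sepShellL H (Zonal.evalE P) x₀)) x)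
    (hdec : Tendsto p₀ (cocompact E3) (𝓝 0))
    (hj : ∀ x : E3, fluxJetTwo (sepShellL H (Zonal.evalE P) x₀) p₀ x₀ x = 0)
    {ŷ : E3} (hŷ : ‖ŷ‖ = 1) {a b q : ℝ} (ha : 0 < a) (hab : a < b) (hK : ∀ r ∈ Ioo a b, vortAmpL l H r = 0)
    (hq : 0 < q) (hqJ : q ∈ closure (Ioo a b))
    (hacc : ∀ ε : ℝ, 0 < ε → ∃ a' b' : ℝ, a' < b' ∧ 0 < a' ∧ Ioo a' b' ⊆ Ioo (q - ε) (q + ε) ∧ ∀ x ∈ Ioo a' b', vortAmpL l H x ≠ 0) :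
    EqOn (premiseRayExp l h P ŷ) 0 (Ioo a b) := by
  have hl1 : 1 ≤ l := by omega
  have hJ : Ioo a b ⊆ Ioi 0 := fun r hr => ha.trans hr.1
  have hsmooth := contDiffOn_premiseRayExp hl1 hh hHh hC P ŷ
  obtain ⟨zs, hz⟩ := premiseRayExp_killed hl1 hh hHh hC P ŷ ha hK
  have hexp := premiseRay_eq_exp hl hP hlap hh hHh hC hsm hdiv hp hpoi hdec hŷ
  -- zero intervals of the closed form accumulate at `q`
  have hZ : ∀ ε : ℝ, 0 < ε → ∃ a' b' : ℝ, a' < b' ∧ 0 < a' ∧ Ioo a' b' ⊆ Ioo (q - ε) (q + ε) ∧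
      EqOn (premiseRayExp l h P ŷ) 0 (Ioo a' b') := by
    intro ε hε
    obtain ⟨a', b', hab', ha', hsub, hKne⟩ := hacc ε hε
    refine ⟨a', b', hab', ha', hsub, fun x hx => ?_⟩
    have hx0 : 0 < x := ha'.trans hx.1
    rw [← hexp hx0]
    exact premiseRay_eq_zero_of_vortAmpL_ne_zero hl1 hP hlap hH hsm hdiv hp hj hŷ hx0 (hKne x hx)
  refine eqOn_zero_of_eulerL_int hsmooth isOpen_Ioo isPreconnected_Ioo (nonempty_Ioo.mpr hab) hJ hq hqJ zs hz ?_
  intro zs' _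
  exact eulerL_apply_eq_zero_of_zero_intervals hsmooth hq _ hZ

/-- ★★ PLATEAU PROPAGATION: if SOME radius has `K ≠ 0`, the ray premise vanishes at every radius `r > 0` (unit `ŷ`, `l ≥ 2`). -/
theorem premiseRay_eq_zero (hl : 2 ≤ l) (hP : P.IsHomogeneous l) (hlap : Zonal.lapP P = 0)
    (hH : VirialAdmissible l H) (hh : ContDiff ℝ ∞ h) (hHh : ∀ r : ℝ, 0 ≤ r → H r = h (r ^ 2))
    (hC : ∀ r : ℝ, 1 ≤ r → r ^ (l + 2) * |H r| ≤ C ∧ r ^ (l + 3) * |deriv H r| ≤ C ∧ r ^ (l + 4) * |deriv (deriv H) r| ≤ C)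
    (hsm : ContDiff ℝ (⊤ : ℕ∞) (sepShellL H (Zonal.evalE P) x₀))
    (hdiv : VectorCalculus.IsDivFree (sepShellL H (Zonal.evalE P) x₀)) (hp : ContDiff ℝ (⊤ : ℕ∞) p₀)
    (hpoi : ∀ x : E3, (Δ p₀) x =
      -VectorCalculus.divergence (convect (sepShellL H (Zonal.evalE P) x₀) (sepShellL H (Zonal.evalE P) x₀)) x)
    (hdec : Tendsto p₀ (cocompact E3) (𝓝 0))
    (hj : ∀ x : E3, fluxJetTwo (sepShellL H (Zonal.evalE P) x₀) p₀ x₀ x = 0)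
    (hS : ∃ s : ℝ, 0 < s ∧ vortAmpL l H s ≠ 0) {ŷ : E3} (hŷ : ‖ŷ‖ = 1) {r : ℝ} (hr : 0 < r) :
    premiseRay l H (Zonal.evalE P) p₀ x₀ ŷ r = 0 := by
  have hl1 : 1 ≤ l := by omega
  by_cases hK : vortAmpL l H r ≠ 0
  · exact premiseRay_eq_zero_of_vortAmpL_ne_zero hl1 hP hlap hH hsm hdiv hp hj hŷ hr hK
  push Not at hK
  have hexp := premiseRay_eq_exp hl hP hlap hh hHh hC hsm hdiv hp hpoi hdec hŷ
  have hsmooth := contDiffOn_premiseRayExp hl1 hh hHh hC P ŷ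
  set F := premiseRayExp l h P ŷ with hFdef
  rw [hexp hr]
  -- either `r` is accumulated by radii with `K ≠ 0`, or it has a `K = 0` neighbourhood
  by_cases hacc : ∀ ε : ℝ, 0 < ε → ∃ s : ℝ, 0 < s ∧ |s - r| < ε ∧ vortAmpL l H s ≠ 0
  · -- continuity of the closed form at `r`
    have hcont : ContinuousAt F r := hsmooth.continuousOn.continuousAt (Ioi_mem_nhds hr)
    by_contra hne
    obtain ⟨ε, hε, hball⟩ := Metric.eventually_nhds_iff.mp (hcont.eventually_ne hne)
    obtain ⟨s, hs0, hsr, hKs⟩ := hacc ε hε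
    refine hball (by rwa [Real.dist_eq]) ?_
    rw [← hexp hs0]
    exact premiseRay_eq_zero_of_vortAmpL_ne_zero hl1 hP hlap hH hsm hdiv hp hj hŷ hs0 hKs
  · push Not at hacc
    obtain ⟨ε₀, hε₀, hflat⟩ := hacc
    -- shrink to `δ ≤ r/2`
    set δ := min ε₀ (r / 2) with hδ
    have hδ0 : 0 < δ := by positivity
    have hδε : δ ≤ ε₀ := min_le_left _ _
    have hδr : δ ≤ r / 2 := min_le_right _ _
    have hKflat : ∀ x : ℝ, 0 < x → |x - r| < δ → vortAmpL l H x = 0 := fun x hx hxr => by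
      by_contra hne; exact absurd (hflat x hx (lt_of_lt_of_le hxr hδε)) (by simpa using hne)
    obtain ⟨s₁, hs₁0, hKs₁⟩ := hS
    rcases lt_or_gt_of_ne (show s₁ ≠ r from fun h => hKs₁ (h ▸ hK)) with hlt | hgt
    · -- a radius with `K ≠ 0` below `r`: peel rightwards from `q = sup (S ∩ (0,r))`
      set T := {x : ℝ | 0 < x ∧ x < r ∧ vortAmpL l H x ≠ 0} with hT
      have hTne : T.Nonempty := ⟨s₁, hs₁0, hlt, hKs₁⟩
      have hTbdd : BddAbove T := ⟨r, fun x hx => hx.2.1.le⟩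
      set q := sSup T with hqdef
      have hq_le : q ≤ r - δ := by
        refine csSup_le hTne fun x hx => ?_
        by_contra hcon
        push Not at hcon
        have : |x - r| < δ := by rw [abs_lt]; constructor <;> linarith [hx.2.1]
        exact hx.2.2 (hKflat x hx.1 this)
      have hq_pos : 0 < q := lt_of_lt_of_le hs₁0 (le_csSup hTbdd ⟨hs₁0, hlt, hKs₁⟩)
      -- the plateau `(q, r + δ)`
      have hKJ : ∀ x ∈ Ioo q (r + δ), vortAmpL l H x = 0 := by
        intro x hx
        have hx0 : 0 < x := hq_pos.trans hx.1
        by_cases hxr : r - δ < x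
        · exact hKflat x hx0 (by rw [abs_lt]; constructor <;> linarith [hx.2])
        · push Not at hxr
          by_contra hne
          have hxT : x ∈ T := ⟨hx0, by linarith, hne⟩
          exact absurd (le_csSup hTbdd hxT) (not_le.mpr hx.1)
      have hacc' : ∀ ε : ℝ, 0 < ε → ∃ a' b' : ℝ, a' < b' ∧ 0 < a' ∧ Ioo a' b' ⊆ Ioo (q - ε) (q + ε) ∧
          ∀ x ∈ Ioo a' b', vortAmpL l H x ≠ 0 := by
        intro ε hε
        obtain ⟨s, hsT, hqs⟩ := exists_lt_of_lt_csSup hTne (show q - ε < q by linarith)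
        have hsq : s ≤ q := le_csSup hTbdd hsT
        obtain ⟨η, hη, hηε, hηs, hKη⟩ := exists_Ioo_vortAmpL_ne_zero l hh hHh hsT.1 hsT.2.2
          (show 0 < min (q + ε - s) (s - (q - ε)) by apply lt_min <;> linarith)
        have hm1 := min_le_left (q + ε - s) (s - (q - ε))
        have hm2 := min_le_right (q + ε - s) (s - (q - ε))
        refine ⟨s - η, s + η, by linarith, by linarith, fun x hx => ⟨?_, ?_⟩, hKη⟩
        · have := hx.1; linarith
        · have := hx.2; linarith
      have hres := premiseRayExp_eqOn_zero_of_plateau hl hP hlap hH hh hHh hC hsm hdiv hp hpoi hdec hj hŷ hq_pos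
        (show q < r + δ by linarith) hKJ hq_pos
        (by rw [closure_Ioo (by linarith : q ≠ r + δ)]; exact ⟨le_rfl, by linarith⟩) hacc'
      exact hres ⟨by linarith, by linarith⟩
    · -- every radius with `K ≠ 0` is above... at least `s₁ > r`: peel leftwards from `q = inf (S ∩ (r,∞))`
      set T := {x : ℝ | r < x ∧ vortAmpL l H x ≠ 0} with hT
      have hTne : T.Nonempty := ⟨s₁, hgt, hKs₁⟩
      have hTbdd : BddBelow T := ⟨r, fun x hx => hx.1.le⟩
      set q := sInf T with hqdef
      have hq_ge : r + δ ≤ q := by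
        refine le_csInf hTne fun x hx => ?_
        by_contra hcon
        push Not at hcon
        have hx0 : 0 < x := hr.trans hx.1
        have : |x - r| < δ := by rw [abs_lt]; constructor <;> linarith [hx.1]
        exact hx.2 (hKflat x hx0 this)
      have hq_pos : 0 < q := by linarith
      have ha' : 0 < r - δ := by linarith
      have hKJ : ∀ x ∈ Ioo (r - δ) q, vortAmpL l H x = 0 := by
        intro x hx
        have hx0 : 0 < x := ha'.trans hx.1
        by_cases hxr : x < r + δ
        · exact hKflat x hx0 (by rw [abs_lt]; constructor <;> linarith [hx.1])
        · push Not at hxr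
          by_contra hne
          have hxT : x ∈ T := ⟨by linarith, hne⟩
          exact absurd (csInf_le hTbdd hxT) (not_le.mpr hx.2)
      have hacc' : ∀ ε : ℝ, 0 < ε → ∃ a' b' : ℝ, a' < b' ∧ 0 < a' ∧ Ioo a' b' ⊆ Ioo (q - ε) (q + ε) ∧
          ∀ x ∈ Ioo a' b', vortAmpL l H x ≠ 0 := by
        intro ε hε
        obtain ⟨s, hsT, hqs⟩ := exists_lt_of_csInf_lt hTne (show q < q + ε by linarith)
        have hsq : q ≤ s := csInf_le hTbdd hsT
        have hs0 : 0 < s := hr.trans hsT.1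
        obtain ⟨η, hη, hηε, hηs, hKη⟩ := exists_Ioo_vortAmpL_ne_zero l hh hHh hs0 hsT.2
          (show 0 < min (q + ε - s) (s - (q - ε)) by apply lt_min <;> linarith)
        have hm1 := min_le_left (q + ε - s) (s - (q - ε))
        have hm2 := min_le_right (q + ε - s) (s - (q - ε))
        refine ⟨s - η, s + η, by linarith, by linarith, fun x hx => ⟨?_, ?_⟩, hKη⟩
        · have := hx.1; linarith
        · have := hx.2; linarith
      have hres := premiseRayExp_eqOn_zero_of_plateau hl hP hlap hH hh hHh hC hsm hdiv hp hpoi hdec hj hŷ ha'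
        (show r - δ < q by linarith) hKJ hq_pos
        (by rw [closure_Ioo (by linarith : r - δ ≠ q)]; exact ⟨by linarith, le_rfl⟩) hacc'
      exact hres ⟨by linarith, by linarith⟩

/-- ★★ THE K-FREE PREMISE EVERYWHERE (`l ≥ 2`, some radius with `K ≠ 0`): for every `y`,
`α(|y|)²·𝒜(y) = {Y, z·∇p₀(x₀+z)}(y)`. -/
theorem premise_of_fluxJetTwo (hl : 2 ≤ l) (hP : P.IsHomogeneous l) (hlap : Zonal.lapP P = 0)
    (hH : VirialAdmissible l H)
    (hsm : ContDiff ℝ (⊤ : ℕ∞) (sepShellL H (Zonal.evalE P) x₀))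
    (hdiv : VectorCalculus.IsDivFree (sepShellL H (Zonal.evalE P) x₀)) (hp : ContDiff ℝ (⊤ : ℕ∞) p₀)
    (hpoi : ∀ x : E3, (Δ p₀) x =
      -VectorCalculus.divergence (convect (sepShellL H (Zonal.evalE P) x₀) (sepShellL H (Zonal.evalE P) x₀)) x)
    (hdec : Tendsto p₀ (cocompact E3) (𝓝 0))
    (hj : ∀ x : E3, fluxJetTwo (sepShellL H (Zonal.evalE P) x₀) p₀ x₀ x = 0)
    (hS : ∃ s : ℝ, 0 < s ∧ vortAmpL l H s ≠ 0) (y : E3) :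
    strainAmpL l H ‖y‖ ^ 2 * angForm (Zonal.evalE P) y =
      pbr (Zonal.evalE P) (fun z : E3 => ⟪z, gradient p₀ (x₀ + z)⟫) y := by
  obtain ⟨⟨h, hh, hHh⟩, C, hC⟩ := id hH
  by_cases hy : y = 0
  · subst hy
    unfold angForm
    rw [pbr_apply_zero, pbr_apply_zero, mul_zero]
  · have hr : 0 < ‖y‖ := norm_pos_iff.mpr hy
    set ŷ : E3 := ‖y‖⁻¹ • y with hŷdef
    have hŷ : ‖ŷ‖ = 1 := by rw [hŷdef, norm_smul, norm_inv, norm_norm, inv_mul_cancel₀ hr.ne']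
    have hyy : y = ‖y‖ • ŷ := by rw [hŷdef, smul_smul, mul_inv_cancel₀ hr.ne', one_smul]
    have key := premiseRay_eq_zero hl hP hlap hH hh hHh hC hsm hdiv hp hpoi hdec hj hS hŷ hr
    unfold premiseRay at key
    rw [← hyy] at key
    linarith

/-- in degree one the angular form vanishes identically (`|∇Y|²` is constant). -/
theorem angForm_eq_zero_of_degree_one {Y : E3 → ℝ} (hY : IsSolidHarmonic 1 Y) (y : E3) : angForm Y y = 0 := by
  obtain ⟨P, hP, hlap, rfl⟩ := hY.exists_evalE
  have hgrad : (fun z : E3 => ‖gradient (Zonal.evalE P) z‖ ^ 2) = fun z => (1 / 2 : ℝ) * Zonal.evalE (sqLapP P 1) z := by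
    funext z; rw [evalE_sqLapP_one hlap]; ring
  unfold angForm
  rw [hgrad, pbr_const_mul _ _ (Zonal.differentiable_evalE _ y), pbr_sqLapP_top hP, mul_zero]

/-- ★★★ THE ORDER-TWO SLICE LAW, BY NAME (`ThreadingJets.OrderTwoSliceLaw`): for EVERY degree `l ≥ 1`, EVERY solid harmonic and EVERY
virial-admissible profile — plateaus included — the decaying slice pressure and a vanishing formal second jet force
`(∫ r^{2l−3}α²)·{Y,|∇Y|²} ≡ 0`: where `K ≠ 0` by (F2), on the plateaus by PLATEAU PROPAGATION (finite power sums, Euler peeling),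
then g8's virial lemma `virialLemmaSlice_holds`. -/
theorem orderTwoSliceLaw_holds : OrderTwoSliceLaw := by
  intro l x₀ Y H p₀ hl hY hH hsm hdiv hp hpoi hdec hj ξ
  -- degree one: the angular form is identically zero
  rcases Nat.lt_or_ge l 2 with hl1 | hl2
  · have : l = 1 := by omega
    subst this
    rw [angForm_eq_zero_of_degree_one hY, mul_zero]
  -- no radius with `K ≠ 0`: the profile is a plateau all the way and the virial moment vanishes
  by_cases hS : ∃ s : ℝ, 0 < s ∧ vortAmpL l H s ≠ 0
  swap
  · push Not at hS
    rw [virialMoment_eq_zero_of_vortAmpL_eq_zero hH hS, zero_mul]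
  -- otherwise the K-free premise holds everywhere and the virial lemma applies
  obtain ⟨P, hP, hlap, rfl⟩ := hY.exists_evalE
  exact virialLemmaSlice_holds l x₀ (Zonal.evalE P) H p₀ hl hY hH hsm hdiv hp hpoi hdec
    (premise_of_fluxJetTwo hl2 hP hlap hH hsm hdiv hp hpoi hdec hj hS) ξ

/-- ★★★ BRIDGE V BY NAME: `VirialHorn.OrderTwoVirialIdentity` holds — for every degree `l ≥ 1`, every solid harmonic, every
virial-admissible profile (plateaus included), every classical Navier–Stokes solution on `[t₀,T)` with decaying pressure issued from the
separable shell whose threading flux is order-two silent at `t₀`. (Jet dictionary `ThreadingJets.orderTwoVirialIdentity_of_sliceLaw`.) -/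
theorem orderTwoVirialIdentity_holds : OrderTwoVirialIdentity :=
  orderTwoVirialIdentity_of_sliceLaw orderTwoSliceLaw_holds

/-- ★★★ THE SEPARABLE SLICE RUNG BY NAME: `VirialHorn.SeparableOrderTwoRigidityL` holds in every degree (bridge V + S-C `angularLemma_holds`,
via `separableOrderTwoRigidityL_of_identity`). -/
theorem separableOrderTwoRigidityL_holds : SeparableOrderTwoRigidityL :=
  separableOrderTwoRigidityL_of_identity orderTwoVirialIdentity_holds angularLemma_holds

end ByName

end Summit.NavierStokesRegularity.NavierStokesRegularity.Theorems.UnthreadedRigidity.VirialHorn
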